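import Summits.ABC.ABC.Theses.StormerPellDescent
import HarnessLib

/-!
# Route StormerPellDescent — glue item `UnitPowerRadical_of_indexSplit` (stmt-ABC-22865)

`Summit.ABC.ABC.Theses.StormerPellDescent.UnitPowerRadical_of_indexSplit :=
FixedIndexUnitRadical → LargeIndexUnitRadical → UnitPowerRadical` — the index split of the crux
`UnitPowerRadical` (stmt-ABC-22187, gen-1 split adopted by idea-crit-6 / director-abc g7-D10, 2026-08-27):
`LargeIndexUnitRadical` supplies `K(ε)` and one constant for all indices `n ≥ K`, `FixedIndexUnitRadical` one
constant `C(k, ε)` for each fixed index `k ≥ 2`; the glue is the FINITE MAXIMUM over `2 ≤ k < K(ε)`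
(`exists_const_forall_lt`, induction on `K`). PROOF-ONLY file (no definition, no `sorry`, standard axioms); the
converse restrictions (`fixedIndexUnitRadical_of_unitPowerRadical`, `largeIndexUnitRadical_of_unitPowerRadical`)
show the split is LOSSLESS: `unitPowerRadical_iff_indexSplit`. Cell `abc-harv`, seat abc-harv-pr-2.
HONESTY: nothing here attacks either child; both stay OPEN (jointly = `UnitPowerRadical`, itself ≤ CONS — NOT abc);
abc is not proved by any of this. [folklore]
-/

noncomputable section

-- `Summit.<Summit>.<Problem>` is the mandated summit-side namespace (CONVENTIONS §2); for the
-- single-conjunct summit `ABC` the two coincide, so the duplicate `ABC.ABC` is deliberate.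
set_option linter.dupNamespace false

namespace Summit.ABC.ABC.Theorems

open UniqueFactorizationMonoid
open Summit.ABC.ABC.Theses.StormerPellDescent

/-- Finite maximum of constants: if for every index `2 ≤ k < K` the fixed-index inequality holds with some
positive constant, one positive constant serves all of them (induction on `K`; the right-hand side is monotone
in the constant because `rad^{1+ε} ≥ 0`). [folklore] -/
theorem exists_const_forall_lt (hFix : FixedIndexUnitRadical) {ε : ℝ} (hε : 0 < ε) (K : ℕ) :
    ∃ C : ℝ, 0 < C ∧ ∀ k : ℕ, 2 ≤ k → k < K → ∀ d : ℕ, Squarefree d → ∀ a : Pell.Solution₁ (d : ℤ),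
      Pell.IsFundamental a →
        ((a ^ k).x : ℝ) < C * ((radical (d * (a ^ k).y.natAbs) : ℕ) : ℝ) ^ (1 + ε) := by
  induction K with
  | zero => exact ⟨1, one_pos, fun k _ hk ↦ absurd hk (Nat.not_lt_zero k)⟩
  | succ K ih =>
    obtain ⟨C, hC, hCb⟩ := ih
    by_cases hK : 2 ≤ K
    · obtain ⟨C', hC', hC'b⟩ := hFix K hK ε hε
      refine ⟨max C C', lt_max_iff.mpr (Or.inl hC), fun k hk hkK d hd a ha ↦ ?_⟩
      have hR : 0 ≤ ((radical (d * (a ^ k).y.natAbs) : ℕ) : ℝ) ^ (1 + ε) :=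
        Real.rpow_nonneg (Nat.cast_nonneg _) _
      rcases Nat.lt_succ_iff_lt_or_eq.mp hkK with hlt | rfl
      · exact (hCb k hk hlt d hd a ha).trans_le (mul_le_mul_of_nonneg_right (le_max_left _ _) hR)
      · exact (hC'b d hd a ha).trans_le (mul_le_mul_of_nonneg_right (le_max_right _ _) hR)
    · refine ⟨C, hC, fun k hk hkK ↦ ?_⟩
      omega

/-- **Item `UnitPowerRadical_of_indexSplit` (stmt-ABC-22865)**: the two children imply the parent crux, with
`C = max(C_large(ε), max_{2 ≤ k < K(ε)} C(k, ε))`. [folklore] -/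
theorem unitPowerRadical_of_indexSplit : UnitPowerRadical_of_indexSplit := by
  intro hFix hLarge ε hε
  obtain ⟨K, C₂, hC₂, hL⟩ := hLarge ε hε
  obtain ⟨C₁, hC₁, hF⟩ := exists_const_forall_lt hFix hε K
  refine ⟨max C₁ C₂, lt_max_iff.mpr (Or.inl hC₁), fun d hd a ha n hn ↦ ?_⟩
  have hR : 0 ≤ ((radical (d * (a ^ n).y.natAbs) : ℕ) : ℝ) ^ (1 + ε) :=
    Real.rpow_nonneg (Nat.cast_nonneg _) _
  rcases Nat.lt_or_ge n K with hnK | hnK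
  · exact (hF n hn hnK d hd a ha).trans_le (mul_le_mul_of_nonneg_right (le_max_left _ _) hR)
  · exact (hL d hd a ha n hnK).trans_le (mul_le_mul_of_nonneg_right (le_max_right _ _) hR)

/-- Converse restriction 1: the parent gives every fixed index. [folklore] -/
theorem fixedIndexUnitRadical_of_unitPowerRadical (h : UnitPowerRadical) : FixedIndexUnitRadical :=
  fun k hk ε hε ↦ (h ε hε).imp fun _ hC ↦ ⟨hC.1, fun d hd a ha ↦ hC.2 d hd a ha k hk⟩

/-- Converse restriction 2: the parent gives the large-index statement with `K = 2`. [folklore] -/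
theorem largeIndexUnitRadical_of_unitPowerRadical (h : UnitPowerRadical) : LargeIndexUnitRadical :=
  fun ε hε ↦ ⟨2, (h ε hε).imp fun _ hC ↦ ⟨hC.1, fun d hd a ha n hn ↦ hC.2 d hd a ha n hn⟩⟩

/-- **The split is lossless**: `UnitPowerRadical ↔ FixedIndexUnitRadical ∧ LargeIndexUnitRadical`. [folklore] -/
theorem unitPowerRadical_iff_indexSplit :
    UnitPowerRadical ↔ FixedIndexUnitRadical ∧ LargeIndexUnitRadical :=
  ⟨fun h ↦ ⟨fixedIndexUnitRadical_of_unitPowerRadical h, largeIndexUnitRadical_of_unitPowerRadical h⟩,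
    fun h ↦ unitPowerRadical_of_indexSplit h.1 h.2⟩

end Summit.ABC.ABC.Theorems

end
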